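import Mathlib
import HarnessLib
import Summits.ValiantsHypothesis.ValiantsHypothesis.Theses.MonotoneRestoration
import Literature.Computability.AlgebraicComplexity.ArithCircuit
import Literature.Computability.AlgebraicComplexity.ArithCircuitProofs
import Literature.Computability.AlgebraicComplexity.MonotoneStructure
import Literature.Computability.AlgebraicComplexity.PermanentIrreducible
import Literature.ModelTheory.FiniteModelTheory.CkEquiv
import Summits.ValiantsHypothesis.ValiantsHypothesis.Theorems.MonotoneRestorationMonotoneRestorationQPCosetCount
import Summits.ValiantsHypothesis.ValiantsHypothesis.Theorems.MonotoneRestorationMonotoneRestorationQPSymmetricLB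
import Summits.ValiantsHypothesis.ValiantsHypothesis.Theorems.MonotoneRestorationMonotoneRestorationQPSupportSymmetrisation
import Summits.ValiantsHypothesis.ValiantsHypothesis.Theorems.MonotoneRestorationMonotoneRestorationQPSparseRegime
import Summits.ValiantsHypothesis.ValiantsHypothesis.Theorems.MonotoneRestorationMonotoneRestorationQPBeta
import Literature.Computability.AlgebraicComplexity.SymmetricArithCircuit
import Literature.Computability.AlgebraicComplexity.DawarWilsenach2025Proofs
import Literature.GroupTheory.PermutationGroups.SmallIndexSubgroups
import Summits.ValiantsHypothesis.ValiantsHypothesis.Theorems.MonotoneRestorationQP.Negative.LoadBearing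
import Summits.ValiantsHypothesis.ValiantsHypothesis.Theorems.MonotoneRestorationMonotoneRestorationQPPermSupportCount
import Summits.ValiantsHypothesis.ValiantsHypothesis.Theorems.MonotoneRestorationMonotoneRestorationQPAltOrbitDichotomy

/-! TTRL-lite variant V14419 of stmt-ValiantsHypothesis-15886 -/

-- `Summit.ValiantsHypothesis.ValiantsHypothesis.…` is the tree's mandated single-conjunct layout
-- (Sub = Summit), so the duplicated namespace component is intended.
set_option linter.dupNamespace false

namespace Summit.ValiantsHypothesis.ValiantsHypothesis.Theorems

open Summit.ValiantsHypothesis.ValiantsHypothesis.Theses.MonotoneRestoration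
open Literature.Computability.AlgebraicComplexity

/-- TTRL-lite variant V14419 (`fix_type:K=Fin3`) of stub `stub_altFixing_orbit_dichotomy` of crux
item `stmt-ValiantsHypothesis-15886`: the orbit dichotomy for `Alt`-fixing groups (an
`Alt([n] ∖ X)`-orbit of a polynomial in the matrix variables, `|X| + 9 ≤ n`, contained in a finite
set `T` with `|T| + |X| < n`, is a point), with the coefficient semiring specialised to `Fin 3`
carrying an arbitrary `CommSemiring` structure.  Immediate from the landed general stub
`stub_altFixing_orbit_dichotomy` (`…QPAltOrbitDichotomy.lean`). [folklore] -/
theorem stub_altFixing_orbit_dichotomy_var14419 :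
    ∀ (n : ℕ) [CommSemiring (Fin 3)] (q : MvPolynomial (Fin n × Fin n) (Fin 3))
      (X : Finset (Fin n)) (h8 : X.card + 9 ≤ n)
      (T : Finset (MvPolynomial (Fin n × Fin n) (Fin 3))) (hT : T.card + X.card < n)
      (horb : ∀ ρ : Equiv.Perm (Fin n), (∀ x ∈ X, ρ x = x) → Equiv.Perm.sign ρ = 1 →
        MvPolynomial.rename (fun p : Fin n × Fin n => (ρ p.1, ρ p.2)) q ∈ T)
      (ρ : Equiv.Perm (Fin n)), (∀ x ∈ X, ρ x = x) → Equiv.Perm.sign ρ = 1 →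
        MvPolynomial.rename (fun p : Fin n × Fin n => (ρ p.1, ρ p.2)) q = q := by
  intro n _ q X h8 T hT horb
  exact stub_altFixing_orbit_dichotomy q X h8 T hT horb

end Summit.ValiantsHypothesis.ValiantsHypothesis.Theorems
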